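import Mathlib
import Literature.NumberTheory.Transcendental.KZHomotopyMoves

/-!
# Sketch — crux-ideate round 1, ideator 3, crux `LegendreCubicForm` (stmt-KontsevichZagierPeriods-3521)

First lemmas of the three idea cards (signatures only; they must elaborate, not be proved):

* card `confocal-octant-one-move`: `ConfocalJacobianIdentity`, `ConfocalOctantTransfer`;
* card `root-band-to-nodal-cubic`: `RootBandCertificate`, `RootTransportToNode`, `NodalFibre`;
* card `diagonal-translate-cauchy-kernel`: `RectangleStokes`, `DiagonalKernelEdgeReduction`.
-/

noncomputable section

set_option linter.dupNamespace false

namespace Summit.KontsevichZagierPeriods.KontsevichZagierPeriods.Cruxes.LegendreCubicForm.Ideator3Published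

open Set MeasureTheory
open Literature.NumberTheory.Transcendental
/-- The crux, restated VERBATIM (signature of item stmt-KontsevichZagierPeriods-3521 =
`Summit.KontsevichZagierPeriods.KontsevichZagierPeriods.Theses.UnfoldedStokes.LegendreCubicForm`; this published copy of
the sketch does not import the route module so that it elaborates independently of route-file rewrites — the seat-folder
`Sketch.lean` attached as item evidence imports the route and names the decl directly; the two agree by `Iff.rfl`). -/
def LegendreCubicForm : Prop :=
  ∀ (e₁ e₂ e₃ : ℚ), e₁ < e₂ → e₂ < e₃ → ∀ (r : Literature.NumberTheory.Transcendental.KZ.IntegralRep 2) (r' : Literature.NumberTheory.Transcendental.KZ.IntegralRep 1), r.domain = {x | (e₁ : ℝ) < x 0 ∧ x 0 < (e₂ : ℝ) ∧ (e₂ : ℝ) < x 1 ∧ x 1 < (e₃ : ℝ)} → Set.EqOn r.integrand (fun x => (x 1 - x 0) / Real.sqrt (|(x 0 - (e₁ : ℝ)) * (x 0 - (e₂ : ℝ)) * (x 0 - (e₃ : ℝ))| * |(x 1 - (e₁ : ℝ)) * (x 1 - (e₂ : ℝ)) * (x 1 - (e₃ : ℝ))|)) r.domain → r'.domain = Set.univ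 → Set.EqOn r'.integrand (fun x => 2 / (1 + x 0 ^ 2)) r'.domain → Literature.NumberTheory.Transcendental.KZ.Equivalent r r'


/-! ## Card 1 — confocal (sphero-conal) coordinates: one change of variables onto the quarter disc -/

/-- Pointwise engine of card 1 (provable now, `field_simp`/`ring` modulo `Real.sq_sqrt`): with
`x_i² = (e_i − l)(e_i − m)/P′(e_i)` one has `X² + Y² + Z² = 1` and the crux integrand equals
`(e₃ − e₁)(m − l)/(X·Y·Z·P′(e₁)·P′(e₃)) = 4·|det D(X,Z)|/Y`. [Bolsinov–Fomenko 2004 §13.3.2; Arnold 1989 App. 15] -/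
def ConfocalJacobianIdentity : Prop :=
  ∀ (e₁ e₂ e₃ l m : ℝ), e₁ < l → l < e₂ → e₂ < m → m < e₃ →
    let X := Real.sqrt ((l - e₁) * (m - e₁) / ((e₂ - e₁) * (e₃ - e₁)))
    let Y := Real.sqrt ((e₂ - l) * (m - e₂) / ((e₂ - e₁) * (e₃ - e₂)))
    let Z := Real.sqrt ((e₃ - l) * (e₃ - m) / ((e₃ - e₁) * (e₃ - e₂)))
    X ^ 2 + Y ^ 2 + Z ^ 2 = 1 ∧
      (m - l) / Real.sqrt (|(l - e₁) * (l - e₂) * (l - e₃)| * |(m - e₁) * (m - e₂) * (m - e₃)|) =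
        (e₃ - e₁) * (m - l) / (X * Y * Z * ((e₂ - e₁) * (e₃ - e₁)) * ((e₃ - e₁) * (e₃ - e₂))) ∧
      -- the same quantity as `4 · |det DΦ| / Y` with the explicit partials of Φ = (X, Z):
      (e₃ - e₁) * (m - l) / (X * Y * Z * ((e₂ - e₁) * (e₃ - e₁)) * ((e₃ - e₁) * (e₃ - e₂))) =
        4 * |((m - e₁) / (2 * X * ((e₂ - e₁) * (e₃ - e₁)))) * (-(e₃ - l) / (2 * Z * ((e₃ - e₁) * (e₃ - e₂))))
            - ((l - e₁) / (2 * X * ((e₂ - e₁) * (e₃ - e₁)))) * (-(e₃ - m) / (2 * Z * ((e₃ - e₁) * (e₃ - e₂))))| / Y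

/-- KERNEL-CHECKED pointwise engine of card 1: the sphere identity, the closed form of the crux integrand
`g = (e₃−e₁)(m−l)/(X·Y·Z·P′(e₁)·P′(e₃))`, and its equality with `4·|det DΦ|/Y` (explicit partials), for all
`e₁ < l < e₂ < m < e₃`. Axioms: propext, Classical.choice, Quot.sound. [Bolsinov–Fomenko 2004 §13.3.2] -/
theorem confocalJacobianIdentity_holds : ConfocalJacobianIdentity := by
  intro e₁ e₂ e₃ l m h1 h2 h3 h4
  -- sign facts
  have p1 : 0 < l - e₁ := by linarith
  have p2 : 0 < m - e₁ := by linarith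
  have p3 : 0 < e₂ - e₁ := by linarith
  have p4 : 0 < e₃ - e₁ := by linarith
  have p5 : 0 < e₂ - l := by linarith
  have p6 : 0 < m - e₂ := by linarith
  have p7 : 0 < e₃ - e₂ := by linarith
  have p8 : 0 < e₃ - l := by linarith
  have p9 : 0 < e₃ - m := by linarith
  have p10 : 0 < m - l := by linarith
  -- the three radicands
  set A := (l - e₁) * (m - e₁) / ((e₂ - e₁) * (e₃ - e₁)) with hA
  set B := (e₂ - l) * (m - e₂) / ((e₂ - e₁) * (e₃ - e₂)) with hB
  set C := (e₃ - l) * (e₃ - m) / ((e₃ - e₁) * (e₃ - e₂)) with hC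
  have hApos : 0 < A := by rw [hA]; positivity
  have hBpos : 0 < B := by rw [hB]; positivity
  have hCpos : 0 < C := by rw [hC]; positivity
  simp only []
  set X := Real.sqrt A with hX
  set Y := Real.sqrt B with hY
  set Z := Real.sqrt C with hZ
  have hXpos : 0 < X := Real.sqrt_pos.mpr hApos
  have hYpos : 0 < Y := Real.sqrt_pos.mpr hBpos
  have hZpos : 0 < Z := Real.sqrt_pos.mpr hCpos
  have hX2 : X ^ 2 = A := Real.sq_sqrt hApos.le
  have hY2 : Y ^ 2 = B := Real.sq_sqrt hBpos.le
  have hZ2 : Z ^ 2 = C := Real.sq_sqrt hCpos.le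
  -- the discriminant square root
  set Δ := (e₂ - e₁) * (e₃ - e₁) * (e₃ - e₂) with hΔ
  have hΔpos : 0 < Δ := by rw [hΔ]; positivity
  refine ⟨?_, ?_, ?_⟩
  · -- sphere identity
    rw [hX2, hY2, hZ2, hA, hB, hC]
    field_simp
    ring
  · -- g = (e₃-e₁)(m-l)/(XYZ D₁ D₃)
    have hPl : |(l - e₁) * (l - e₂) * (l - e₃)| = (l - e₁) * (e₂ - l) * (e₃ - l) := by
      have : (l - e₁) * (l - e₂) * (l - e₃) = (l - e₁) * (e₂ - l) * (e₃ - l) := by ring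
      rw [this, abs_of_pos (by positivity)]
    have hPm : |(m - e₁) * (m - e₂) * (m - e₃)| = (m - e₁) * (m - e₂) * (e₃ - m) := by
      have : (m - e₁) * (m - e₂) * (m - e₃) = -((m - e₁) * (m - e₂) * (e₃ - m)) := by ring
      rw [this, abs_neg, abs_of_pos (by positivity)]
    have key : Real.sqrt (|(l - e₁) * (l - e₂) * (l - e₃)| * |(m - e₁) * (m - e₂) * (m - e₃)|) =
        X * Y * Z * Δ := by
      rw [hPl, hPm, hX, hY, hZ, ← Real.sqrt_mul hApos.le, ← Real.sqrt_mul (by positivity),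
        ← Real.sqrt_sq hΔpos.le, ← Real.sqrt_mul (by positivity)]
      congr 1
      rw [hA, hB, hC, hΔ]
      field_simp
    rw [key]
    field_simp
    ring
  · -- 4|det|/Y form
    have hdet : ((m - e₁) / (2 * X * ((e₂ - e₁) * (e₃ - e₁)))) * (-(e₃ - l) / (2 * Z * ((e₃ - e₁) * (e₃ - e₂))))
            - ((l - e₁) / (2 * X * ((e₂ - e₁) * (e₃ - e₁)))) * (-(e₃ - m) / (2 * Z * ((e₃ - e₁) * (e₃ - e₂))))
          = -((e₃ - e₁) * (m - l) / (4 * X * Z * ((e₂ - e₁) * (e₃ - e₁)) * ((e₃ - e₁) * (e₃ - e₂)))) := by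
      field_simp
      ring
    rw [hdet, abs_neg, abs_of_pos (by positivity)]
    field_simp

/-- FIRST LEMMA of card 1: the crux representation is ONE `changeOfVariablesRel` instance away from
the quarter-disc chart of the positive octant of `S²` with `4×` the round area density, along
`Φ(l,m) = (X,Z) = (√((l−e₁)(m−e₁)/((e₂−e₁)(e₃−e₁))), √((e₃−l)(e₃−m)/((e₃−e₁)(e₃−e₂))))`. -/
def ConfocalOctantTransfer : Prop :=
  ∀ (e₁ e₂ e₃ : ℚ), e₁ < e₂ → e₂ < e₃ →
  ∀ (r rQ : KZ.IntegralRep 2),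
    r.domain = {x | (e₁ : ℝ) < x 0 ∧ x 0 < (e₂ : ℝ) ∧ (e₂ : ℝ) < x 1 ∧ x 1 < (e₃ : ℝ)} →
    Set.EqOn r.integrand (fun x => (x 1 - x 0) /
      Real.sqrt (|(x 0 - (e₁ : ℝ)) * (x 0 - (e₂ : ℝ)) * (x 0 - (e₃ : ℝ))| *
        |(x 1 - (e₁ : ℝ)) * (x 1 - (e₂ : ℝ)) * (x 1 - (e₃ : ℝ))|)) r.domain →
    rQ.domain = {p | 0 < p 0 ∧ 0 < p 1 ∧ p 0 ^ 2 + p 1 ^ 2 < 1} →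
    Set.EqOn rQ.integrand (fun p => 4 / Real.sqrt (1 - p 0 ^ 2 - p 1 ^ 2)) rQ.domain →
    KZ.of r - KZ.of rQ ∈ KZ.changeOfVariablesRel

/-- The remaining genus-0 tail of card 1 (quarter disc → rational polar chart → one radial
Newton–Leibniz move → arctangent folding), recorded so that the composition is visible:
`ConfocalOctantTransfer ∧ QuarterDiscTail → LegendreCubicForm` is bookkeeping in `KZ.relations`. -/
def QuarterDiscTail : Prop :=
  ∀ (rQ : KZ.IntegralRep 2) (r' : KZ.IntegralRep 1),
    rQ.domain = {p | 0 < p 0 ∧ 0 < p 1 ∧ p 0 ^ 2 + p 1 ^ 2 < 1} →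
    Set.EqOn rQ.integrand (fun p => 4 / Real.sqrt (1 - p 0 ^ 2 - p 1 ^ 2)) rQ.domain →
    r'.domain = Set.univ → Set.EqOn r'.integrand (fun x => 2 / (1 + x 0 ^ 2)) r'.domain →
    KZ.Equivalent rQ r'

/-! ## Card 2 — Gauss–Manin band in the root parameter down to the nodal cubic -/

/-- The rescaled one-representation family of the crux: roots `(0, σ, 1)`, charts `x = σ s` on the
real gap and `y = σ + (1 − σ) t` on the imaginary gap. `G σ (s,t)` has value `2π` for every
`σ ∈ (0,1)` and extends continuously to the NODAL fibre `σ = 0`, where it is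
`1/(√(s(1−s)) √(1−t))`. -/
def G (σ : ℝ) (z : Fin 2 → ℝ) : ℝ :=
  (σ + (1 - σ) * z 1 - σ * z 0) /
    (Real.sqrt (z 0 * (1 - z 0) * (1 - σ * z 0)) * Real.sqrt (z 1 * (1 - z 1) * (σ + (1 - σ) * z 1)))

/-- Certificate piece in the `s`-direction (vanishes at `s = 0, 1`): `(1 − s) · Ω`, `Ω = s(1−t)/(w₁ w₂)`. -/
def certA (σ : ℝ) (z : Fin 2 → ℝ) : ℝ :=
  z 0 * (1 - z 0) * (1 - z 1) /
    (Real.sqrt (z 0 * (1 - z 0) * (1 - σ * z 0)) * Real.sqrt (z 1 * (1 - z 1) * (σ + (1 - σ) * z 1)))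

/-- Certificate piece in the `t`-direction (vanishes at `t = 0, 1`): `t · Ω`. -/
def certB (σ : ℝ) (z : Fin 2 → ℝ) : ℝ :=
  z 0 * z 1 * (1 - z 1) /
    (Real.sqrt (z 0 * (1 - z 0) * (1 - σ * z 0)) * Real.sqrt (z 1 * (1 - z 1) * (σ + (1 - σ) * z 1)))

/-- Pointwise engine of card 2 (the Picard–Fuchs / Gauss–Manin exactness certificate, checked by
finite differences to 3e−7 in `num/card2_band.py`): `∂_σ G = ∂_s certA + ∂_t certB` on the open cube. -/
def RootBandCertificate : Prop :=
  ∀ (σ : ℝ) (z : Fin 2 → ℝ), σ ∈ Set.Ioo (0 : ℝ) 1 → (∀ i, z i ∈ Set.Ioo (0 : ℝ) 1) →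
    HasDerivAt (fun σ' : ℝ => G σ' z)
      (deriv (fun s : ℝ => certA σ (Function.update z 0 s)) (z 0) +
        deriv (fun t : ℝ => certB σ (Function.update z 1 t)) (z 1)) σ

/-- FIRST LEMMA of card 2: flat transport of the rescaled crux representation to the nodal fibre —
one `newtonLeibnizRel` instance in the parameter (band `(0,1)² × [0,σ]`, primitive the family `G`
itself), integrand additivity, and two zero-face Newton–Leibniz moves on the certificate pieces. -/
def RootTransportToNode : Prop :=
  ∀ (σ : ℚ), 0 < σ → σ < 1 → ∀ (rσ r₀ : KZ.IntegralRep 2),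
    rσ.domain = {z | ∀ i, z i ∈ Set.Ioo (0 : ℝ) 1} → Set.EqOn rσ.integrand (G σ) rσ.domain →
    r₀.domain = {z | ∀ i, z i ∈ Set.Ioo (0 : ℝ) 1} →
    Set.EqOn r₀.integrand (fun z => 1 / (Real.sqrt (z 0 * (1 - z 0)) * Real.sqrt (1 - z 1))) r₀.domain →
    KZ.Equivalent rσ r₀

/-- The nodal fibre is elementary: `[(0,1)², 1/(√(s(1−s))√(1−t))] ~ [ℝ, 2/(1+x²)]`
(one Newton–Leibniz move in `t`, primitive `−2√(1−t)/√(s(1−s))`, then the arcsine/arctangent tail). -/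
def NodalFibre : Prop :=
  ∀ (r₀ : KZ.IntegralRep 2) (r' : KZ.IntegralRep 1),
    r₀.domain = {z | ∀ i, z i ∈ Set.Ioo (0 : ℝ) 1} →
    Set.EqOn r₀.integrand (fun z => 1 / (Real.sqrt (z 0 * (1 - z 0)) * Real.sqrt (1 - z 1))) r₀.domain →
    r'.domain = Set.univ → Set.EqOn r'.integrand (fun x => 2 / (1 + x 0 ^ 2)) r'.domain →
    KZ.Equivalent r₀ r'

/-! ## Card 3 — Stokes on the real cell with the translated-diagonal Cauchy kernel -/

/-- Stokes on an open rectangle with NON-ZERO edge values, as two Newton–Leibniz moves plus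
integrand additivity (the generic move pattern card 3 needs; compare `KZStokesBox`, which is the
zero-face case): if `g = ∂₀ N − ∂₁ M` on `(a,b) × (c,d)` with `N`, `M` `ℚ`-semialgebraic,
continuous on the closed `0`-fibres resp. `1`-fibres, each partial absolutely integrable, then
`[R, g] − [(c,d), N(b,·) − N(a,·)] − [(a,b), M(·,c) − M(·,d)] ∈ KZ.relations`. -/
def RectangleStokes : Prop :=
  ∀ (a b c d : ℚ), a < b → c < d →
  ∀ (M N N₀ M₁ : (Fin 2 → ℝ) → ℝ) (r rN rM : KZ.IntegralRep 2) (r₂ r₁ : KZ.IntegralRep 1),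
    r.domain = {z | (a : ℝ) < z 0 ∧ z 0 < (b : ℝ) ∧ (c : ℝ) < z 1 ∧ z 1 < (d : ℝ)} →
    rN.domain = r.domain → rM.domain = r.domain →
    IsSemialgebraicFunOn ℚ {z | (a : ℝ) ≤ z 0 ∧ z 0 ≤ (b : ℝ) ∧ (c : ℝ) < z 1 ∧ z 1 < (d : ℝ)} N →
    IsSemialgebraicFunOn ℚ {z | (a : ℝ) < z 0 ∧ z 0 < (b : ℝ) ∧ (c : ℝ) ≤ z 1 ∧ z 1 ≤ (d : ℝ)} M →
    (∀ y ∈ Set.Ioo (c : ℝ) d, ContinuousOn (fun x : ℝ => N ![x, y]) (Set.Icc (a : ℝ) b)) →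
    (∀ x ∈ Set.Ioo (a : ℝ) b, ContinuousOn (fun y : ℝ => M ![x, y]) (Set.Icc (c : ℝ) d)) →
    (∀ z ∈ r.domain, HasDerivAt (fun x : ℝ => N ![x, z 1]) (N₀ z) (z 0)) →
    (∀ z ∈ r.domain, HasDerivAt (fun y : ℝ => M ![z 0, y]) (M₁ z) (z 1)) →
    Set.EqOn rN.integrand N₀ r.domain → Set.EqOn rM.integrand (fun z => - M₁ z) r.domain →
    Set.EqOn r.integrand (fun z => N₀ z - M₁ z) r.domain →
    r₂.domain = {y | (c : ℝ) < y 0 ∧ y 0 < (d : ℝ)} →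
    Set.EqOn r₂.integrand (fun y => N ![b, y 0] - N ![a, y 0]) r₂.domain →
    r₁.domain = {x | (a : ℝ) < x 0 ∧ x 0 < (b : ℝ)} →
    Set.EqOn r₁.integrand (fun x => M ![x 0, c] - M ![x 0, d]) r₁.domain →
    KZ.of r - KZ.of r₂ - KZ.of r₁ ∈ KZ.relations

/-- FIRST LEMMA of card 3 (shape of the edge reduction): Stokes with the real/imaginary parts of
the kernel `f(P,Q)(du − dv)`, `f = ζ(u−v−c) − ζ(u) + ζ(v) + ζ(c)` written algebraically as
`(y_P + y_{Q+a})/(x_P − x_{Q+a}) − (y_Q − y_a)/(x_Q − x_a)` with `a = P₀ − Q₀` parked in the opposite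
quarter, reduces the crux representation to two 1-dimensional ARGUMENT-DERIVATIVE representations
`2·d arg h₂` on the imaginary gap and `−2·d arg h₁` on the real gap, for `ℚ`-semialgebraic
complex-valued algebraic functions `hⱼ = pⱼ + i qⱼ` (explicitly `h₂(Q) = (x(Q+a) − e₁)/(x(Q+a) − e₂)`,
`h₁(P) = (x(P−a) − e₂)/(x(P−a) − e₃)`); the quasi-periods never appear. -/
def DiagonalKernelEdgeReduction : Prop :=
  ∀ (e₁ e₂ e₃ : ℚ), e₁ < e₂ → e₂ < e₃ →
  ∃ (p₁ q₁ p₁' q₁' p₂ q₂ p₂' q₂' : ℝ → ℝ),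
    IsSemialgebraicFunOn ℚ {x : Fin 1 → ℝ | (e₁ : ℝ) ≤ x 0 ∧ x 0 ≤ (e₂ : ℝ)} (fun x => p₁ (x 0)) ∧
    IsSemialgebraicFunOn ℚ {x : Fin 1 → ℝ | (e₁ : ℝ) ≤ x 0 ∧ x 0 ≤ (e₂ : ℝ)} (fun x => q₁ (x 0)) ∧
    IsSemialgebraicFunOn ℚ {x : Fin 1 → ℝ | (e₂ : ℝ) ≤ x 0 ∧ x 0 ≤ (e₃ : ℝ)} (fun x => p₂ (x 0)) ∧
    IsSemialgebraicFunOn ℚ {x : Fin 1 → ℝ | (e₂ : ℝ) ≤ x 0 ∧ x 0 ≤ (e₃ : ℝ)} (fun x => q₂ (x 0)) ∧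
    (∀ x ∈ Set.Ioo (e₁ : ℝ) e₂, HasDerivAt p₁ (p₁' x) x ∧ HasDerivAt q₁ (q₁' x) x ∧ p₁ x ^ 2 + q₁ x ^ 2 ≠ 0) ∧
    (∀ y ∈ Set.Ioo (e₂ : ℝ) e₃, HasDerivAt p₂ (p₂' y) y ∧ HasDerivAt q₂ (q₂' y) y ∧ p₂ y ^ 2 + q₂ y ^ 2 ≠ 0) ∧
    ∀ (r : KZ.IntegralRep 2) (r₂ r₁ : KZ.IntegralRep 1),
      r.domain = {x | (e₁ : ℝ) < x 0 ∧ x 0 < (e₂ : ℝ) ∧ (e₂ : ℝ) < x 1 ∧ x 1 < (e₃ : ℝ)} →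
      Set.EqOn r.integrand (fun x => (x 1 - x 0) /
        Real.sqrt (|(x 0 - (e₁ : ℝ)) * (x 0 - (e₂ : ℝ)) * (x 0 - (e₃ : ℝ))| *
          |(x 1 - (e₁ : ℝ)) * (x 1 - (e₂ : ℝ)) * (x 1 - (e₃ : ℝ))|)) r.domain →
      r₂.domain = {y | (e₂ : ℝ) < y 0 ∧ y 0 < (e₃ : ℝ)} →
      Set.EqOn r₂.integrand
        (fun y => 2 * (p₂ (y 0) * q₂' (y 0) - q₂ (y 0) * p₂' (y 0)) / (p₂ (y 0) ^ 2 + q₂ (y 0) ^ 2)) r₂.domain →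
      r₁.domain = {x | (e₁ : ℝ) < x 0 ∧ x 0 < (e₂ : ℝ)} →
      Set.EqOn r₁.integrand
        (fun x => -2 * (p₁ (x 0) * q₁' (x 0) - q₁ (x 0) * p₁' (x 0)) / (p₁ (x 0) ^ 2 + q₁ (x 0) ^ 2)) r₁.domain →
      KZ.of r - KZ.of r₂ - KZ.of r₁ ∈ KZ.relations

/-- Sanity: the three lines all conclude the crux BY NAME once their tails are supplied
(bookkeeping compositions, not proved here). -/
def CardShapes : Prop :=
  (ConfocalOctantTransfer → QuarterDiscTail → LegendreCubicForm) ∧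
  (RootTransportToNode → NodalFibre → LegendreCubicForm) ∧
  (DiagonalKernelEdgeReduction → LegendreCubicForm)

end Summit.KontsevichZagierPeriods.KontsevichZagierPeriods.Cruxes.LegendreCubicForm.Ideator3Published
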